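/-
Copyright (c) 2026 the pub-hodgecm-mathlib formalisation cell (harness21).  Prover seat hodgecm-mathlib-B-p04 (g34) — EP PEN of (R2) (LEAD F0P3a-plan (g9)
WORD T8-167, desk F0P3-plan (g8) dedup 2026-09-01T08:07:50Z, token ruling 08:12:47Z), 2026-09-01.  FILE (R3b) of the Euler–Poincaré road for
`stub_N6nsR2EP : RankOneEulerPoincareNonsplit` (type (1) EDGE COUNT; the star counts are shared with B-p10 (g25)'s (ii) `𝟙_I` non-elliptic unfolding).
-/
import Mathlib.LinearAlgebra.Projectivization.Action
import Mathlib.LinearAlgebra.Projectivization.Cardinality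
import Literature.NumberTheory.Automorphic.UnitaryTwoIsotropicEigenLines
import Literature.NumberTheory.Automorphic.IwahoriGL
import Literature.NumberTheory.Automorphic.UnitaryGroupAutomorphicRep
import HarnessLib

/-!
# The `τ`-hermitian projective line `ℙ(𝓀²)`: its `q + 1` isotropic points, their fixed-point counts, and the reduction of `K = U(Φ₂) ∩ GL₂(𝒪)`

Topic `NumberTheory/Automorphic`, namespace `Literature.NumberTheory.Automorphic`.  THEOREMS ONLY: no definition, no named fact, no instance, no
notation, no `sorry`; kernel lane.  FILE (R3b) of the EP road (brick (2b/2c) of `CENSUS-R2EP-RankOneEulerPoincare.B-p04g34.md`), between ★ (R3a)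
`UnitaryTwoIsotropicEigenLines` (eigen-line algebra) and (R3c) `UnitaryTwoIwahoriStarFixedPoints` (the counts on the Iwahori star `K ⧸ I`).

THE MATHEMATICS.  §2: over a field `κ` with endomorphism `τ` and `J = Φ₂ = antidiag(1,1)`, the ISOTROPIC points of `ℙ(κ²)` (`ᵗτ(x) Φ₂ x = 0`, a
condition independent of the representative) are `⟨(0,1)⟩` and the `⟨(1,t)⟩` with `τ t = −t` (`eq_mk_or_exists_eq_mk_of_isotropic`), so they number
`#{t : τ t = −t} + 1` (`natCard_isotropic_eq`; `= q + 1` for the residual involution of an unramified quadratic extension, `|κ| = q²`) — the star of a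
hyperspecial vertex of the Bruhat–Tits tree of `U(1,1)` [Serre1980Trees, II.1.1].  For `M ∈ GL₂(κ)` `τ`-unitary, the `M`-fixed isotropic points number
ALL of them if `M` is scalar (`natCard_isotropic_fixed_of_coe_eq_smul_one`), exactly ONE if `(M − λ)² = 0 ≠ M − λ` with `τλ·λ = 1`
(`natCard_isotropic_fixed_eq_one_of_sq_eq_zero`), and NONE if `M` has two distinct norm-one eigenvalues (`natCard_isotropic_fixed_eq_zero_of_eigenpair`)
— Kottwitz's local fixed-edge multiplicities [Kottwitz1988, §2].  §3: for a field `F` with a `ValuativeRel`, an endomorphism `σ` of `F` restricting to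
`σO` on `𝒪 = 𝒪[F]` with reduction `τ` on `𝓀 = 𝓀[F]`, and `K = U(σ, Φ₂) ∩ GL₂(𝒪) ⊇ I = U ∩ Iwahori` (★ `glInt`, `iwahoriGL`, `unitaryGroupOfForm`):
the reduction `k̄ = glIntReduction k` (★) is `τ`-unitary for `Φ₂` over `𝓀` (`transpose_map_glIntReduction_mul_antidiagTwo_mul`), `k ∈ I` iff `k̄` fixes
`⟨ē₀⟩ = ⟨(1,0)⟩` (`mem_iwahori_subgroupOf_iff_smul_eq` — the Iwahori subgroup is the preimage of the Borel [IwahoriMatsumoto1965, §2]), and `k̄ ⟨ē₀⟩`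
is isotropic (`isotropic_glIntReduction_smul`).
HONEST LABEL: HC_CM is proved only modulo the cell's remaining named inputs (hLiu418, h413) until rung 0 closes; this file is unconditional algebra.

## References
* [Kottwitz1988] R. E. Kottwitz, *Tamagawa numbers*, Ann. of Math. 127 (1988), 629–646, §2 (Euler–Poincaré functions; `O_γ(f_EP) = χ(X^γ)`).
* [Serre1980Trees] J.-P. Serre, *Trees* (1980), Ch. II §1.1 (the tree of `SL₂` over a local field; the star of a vertex = `ℙ¹` of the residue field).
* [Rogawski1990] J. D. Rogawski, *Automorphic Representations of Unitary Groups in Three Variables* (1990), §12.6–12.7 pp. 174–176 (Lemma 12.7.1).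
* [IwahoriMatsumoto1965] N. Iwahori, H. Matsumoto, Publ. Math. IHÉS 25 (1965), §2 (Iwahori subgroup = preimage of the Borel under reduction).
* [Serre1979] J.-P. Serre, *Local Fields*, GTM 67 (1979), Ch. V §2 Prop. 2–3 (unramified quadratic extensions: trace and fixed points).
-/

set_option autoImplicit false

open scoped ValuativeRel Matrix MatrixGroups
open Matrix ValuativeRel

namespace Literature.NumberTheory.Automorphic

/-! ## §2 The isotropic points of the `τ`-hermitian projective line `ℙ(κ²)`, `J = antidiag(1, 1)` -/

section ProjectiveLine

variable {κ : Type*} [Field κ] (τ : κ →+* κ)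

/-- Isotropy of a point of `ℙ(κ²)` does not depend on the representative: `ᵗτ(rep) J rep = 0 ↔ ᵗτ(v) J v = 0` for `x = ⟨v⟩`. [cite: BourbakiAlgebreIX2007, §1 no. 1] -/
theorem vecMul_dotProduct_rep_eq_zero_iff (J : Matrix (Fin 2) (Fin 2) κ) (v : Fin 2 → κ) (hv : v ≠ 0) :
    ((τ ∘ (Projectivization.mk κ v hv).rep) ᵥ* J) ⬝ᵥ (Projectivization.mk κ v hv).rep = 0 ↔ ((τ ∘ v) ᵥ* J) ⬝ᵥ v = 0 := by
  obtain ⟨a, ha⟩ := Projectivization.exists_smul_eq_mk_rep κ v hv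
  rw [← ha, Units.smul_def, map_comp_smul_vecMul_dotProduct_smul, mul_eq_zero, mul_eq_zero, map_eq_zero, or_self,
    or_iff_right a.ne_zero]

/-- The antidiagonal hermitian form in coordinates: `ᵗτ(v) Φ₂ w = τ(v₀) w₁ + τ(v₁) w₀`. [cite: Rogawski1990, §12.6 p. 174] -/
theorem vecMul_antidiag_dotProduct (v w : Fin 2 → κ) :
    ((τ ∘ v) ᵥ* !![(0 : κ), 1; 1, 0]) ⬝ᵥ w = τ (v 0) * w 1 + τ (v 1) * w 0 := by
  simp [vecMul, dotProduct, Fin.sum_univ_two]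
  ring

/-- `M • ⟨v⟩ = ⟨v⟩ ↔ v is an eigenvector of M` (`M ∈ GL₂(κ)` acting on `ℙ(κ²)`). [cite: HornJohnson2013, §1.1] -/
theorem smul_mk_eq_self_iff (M : GL (Fin 2) κ) (v : Fin 2 → κ) (hv : v ≠ 0) :
    M • Projectivization.mk κ v hv = Projectivization.mk κ v hv ↔ ∃ a : κ, (M : Matrix (Fin 2) (Fin 2) κ) *ᵥ v = a • v := by
  rw [Projectivization.smul_mk, Projectivization.mk_eq_mk_iff']
  exact ⟨fun ⟨a, ha⟩ => ⟨a, ha.symm⟩, fun ⟨a, ha⟩ => ⟨a, ha.symm⟩⟩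

/-- **The isotropic points are `⟨(0, 1)⟩` and the `⟨(1, t)⟩` with `τ t = −t`.** [cite: Serre1980Trees, Ch. II §1.1] -/
theorem eq_mk_or_exists_eq_mk_of_isotropic (x : Projectivization κ (Fin 2 → κ))
    (hx : ((τ ∘ x.rep) ᵥ* !![(0 : κ), 1; 1, 0]) ⬝ᵥ x.rep = 0) (h01 : (![0, 1] : Fin 2 → κ) ≠ 0) (h10 : ∀ t : κ, (![1, t] : Fin 2 → κ) ≠ 0) :
    x = Projectivization.mk κ ![0, 1] h01 ∨ ∃ t : κ, τ t = -t ∧ x = Projectivization.mk κ ![1, t] (h10 t) := by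
  induction x using Projectivization.ind with
  | h v hv =>
    have hx' : τ (v 0) * v 1 + τ (v 1) * v 0 = 0 := by
      rwa [vecMul_dotProduct_rep_eq_zero_iff, vecMul_antidiag_dotProduct] at hx
    by_cases hv0 : v 0 = 0
    · left
      have hv1 : v 1 ≠ 0 := by
        intro h1; apply hv; funext i; fin_cases i
        · exact hv0
        · exact h1
      refine (Projectivization.mk_eq_mk_iff' κ _ _ hv h01).2 ⟨v 1, ?_⟩
      funext i; fin_cases i
      · simp [hv0]
      · simp
    · right
      have ht : τ (v 1 / v 0) = -(v 1 / v 0) := by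
        have hτ0 : τ (v 0) ≠ 0 := by rwa [map_ne_zero]
        rw [map_div₀, eq_neg_iff_add_eq_zero, div_add_div _ _ hτ0 hv0, div_eq_zero_iff]
        left
        linear_combination hx'
      refine ⟨v 1 / v 0, ht, (Projectivization.mk_eq_mk_iff' κ _ _ hv (h10 _)).2 ⟨v 0, ?_⟩⟩
      funext i; fin_cases i
      · simp
      · simp [mul_div_cancel₀ _ hv0]

/-- **`#{isotropic points of ℙ(κ²)} = #{t ∈ κ : τ t = −t} + 1`**: the isotropic points are `⟨(1, t)⟩` with `t + τ t = 0` and `⟨(0, 1)⟩` (the `q + 1`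
neighbours of a hyperspecial vertex in the tree of `U(1,1)`). [cite: Serre1980Trees, Ch. II §1.1] [cite: Kottwitz1988, §2] -/
theorem natCard_isotropic_eq [Finite κ] :
    Nat.card {x : Projectivization κ (Fin 2 → κ) // ((τ ∘ x.rep) ᵥ* !![(0 : κ), 1; 1, 0]) ⬝ᵥ x.rep = 0} = Nat.card {t : κ // τ t = -t} + 1 := by
  classical
  have h10 : ∀ t : κ, (![1, t] : Fin 2 → κ) ≠ 0 := fun t h => by simpa using congrFun h 0
  have h01 : (![0, 1] : Fin 2 → κ) ≠ 0 := fun h => by simpa using congrFun h 1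
  -- the parametrisation
  set f : Option {t : κ // τ t = -t} → {x : Projectivization κ (Fin 2 → κ) // ((τ ∘ x.rep) ᵥ* !![(0 : κ), 1; 1, 0]) ⬝ᵥ x.rep = 0} :=
    fun o => match o with
      | none => ⟨Projectivization.mk κ ![0, 1] h01, by
          rw [vecMul_dotProduct_rep_eq_zero_iff, vecMul_antidiag_dotProduct]; simp⟩
      | some t => ⟨Projectivization.mk κ ![1, (t : κ)] (h10 t), by
          rw [vecMul_dotProduct_rep_eq_zero_iff, vecMul_antidiag_dotProduct]
          simp only [cons_val_zero, cons_val_one, map_one, mul_one, one_mul, t.2, add_neg_cancel]⟩ with hf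
  have hinj : Function.Injective f := by
    rintro (_ | t) (_ | t') h
    · rfl
    · exfalso
      have h' := congrArg (fun y => (y.1 : Projectivization κ (Fin 2 → κ))) h
      simp only [hf] at h'
      obtain ⟨a, ha⟩ := (Projectivization.mk_eq_mk_iff' κ _ _ h01 (h10 t')).1 h'
      have h0 := congrFun ha 0
      have h1 := congrFun ha 1
      simp at h0 h1
      simp [h0] at h1
    · exfalso
      have h' := congrArg (fun y => (y.1 : Projectivization κ (Fin 2 → κ))) h
      simp only [hf] at h'
      obtain ⟨a, ha⟩ := (Projectivization.mk_eq_mk_iff' κ _ _ (h10 t) h01).1 h'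
      have := congrFun ha 0
      simp at this
    · have h' := congrArg (fun y => (y.1 : Projectivization κ (Fin 2 → κ))) h
      simp only [hf] at h'
      obtain ⟨a, ha⟩ := (Projectivization.mk_eq_mk_iff' κ _ _ (h10 t) (h10 t')).1 h'
      have h0 := congrFun ha 0
      have h1 := congrFun ha 1
      simp only [Pi.smul_apply, cons_val_zero, cons_val_one, smul_eq_mul, mul_one] at h0 h1
      rw [h0, one_mul] at h1
      congr 1
      exact Subtype.ext h1.symm
  have hsurj : Function.Surjective f := by
    rintro ⟨x, hx⟩
    rcases eq_mk_or_exists_eq_mk_of_isotropic τ x hx h01 h10 with rfl | ⟨t, ht, rfl⟩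
    · exact ⟨none, Subtype.ext (by simp only [hf])⟩
    · exact ⟨some ⟨t, ht⟩, Subtype.ext (by simp only [hf])⟩
  rw [← Finite.card_option, Nat.card_eq_of_bijective f ⟨hinj, hsurj⟩]

/-- **Scalar reduction fixes the whole star**: if `↑M = c • 1` then every isotropic point is `M`-fixed, so the fixed isotropic points number
`#{τ t = −t} + 1`. [cite: Kottwitz1988, §2] -/
theorem natCard_isotropic_fixed_of_coe_eq_smul_one [Finite κ] (M : GL (Fin 2) κ) {c : κ} (hM : (M : Matrix (Fin 2) (Fin 2) κ) = c • 1) :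
    Nat.card {x : Projectivization κ (Fin 2 → κ) // ((τ ∘ x.rep) ᵥ* !![(0 : κ), 1; 1, 0]) ⬝ᵥ x.rep = 0 ∧ M • x = x} =
      Nat.card {t : κ // τ t = -t} + 1 := by
  rw [← natCard_isotropic_eq τ]
  refine Nat.card_congr (Equiv.subtypeEquivRight fun x => ?_)
  rw [and_iff_left_iff_imp]
  intro _
  induction x using Projectivization.ind with
  | h v hv => exact (smul_mk_eq_self_iff M v hv).2 ⟨c, by rw [hM, smul_mulVec, one_mulVec]⟩

/-- **Double eigenvalue, non-scalar ⇒ exactly ONE fixed isotropic point** (`J = Φ₂`): `(M − λ)² = 0`, `M ≠ λ`, `τλ·λ = 1`, `M` `τ`-unitary ⇒ the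
fixed points of `M` on `ℙ(κ²)` are the single line `ker(M − λ)`, and it is isotropic. [cite: Kottwitz1988, §2] -/
theorem natCard_isotropic_fixed_eq_one_of_sq_eq_zero [Finite κ] (M : GL (Fin 2) κ)
    (hM : ((M : Matrix (Fin 2) (Fin 2) κ).map τ)ᵀ * !![(0 : κ), 1; 1, 0] * (M : Matrix (Fin 2) (Fin 2) κ) = !![(0 : κ), 1; 1, 0]) {l : κ}
    (hsq : ((M : Matrix (Fin 2) (Fin 2) κ) - l • 1) * ((M : Matrix (Fin 2) (Fin 2) κ) - l • 1) = 0)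
    (hne : (M : Matrix (Fin 2) (Fin 2) κ) ≠ l • 1) (hl : τ l * l = 1) :
    Nat.card {x : Projectivization κ (Fin 2 → κ) // ((τ ∘ x.rep) ᵥ* !![(0 : κ), 1; 1, 0]) ⬝ᵥ x.rep = 0 ∧ M • x = x} = 1 := by
  obtain ⟨v, hv0, hv, hiso⟩ := exists_isotropic_eigenvector_of_sq_eq_zero τ hM hsq hne hl
  rw [Nat.card_eq_one_iff_exists]
  refine ⟨⟨Projectivization.mk κ v hv0, (vecMul_dotProduct_rep_eq_zero_iff τ _ v hv0).2 hiso, (smul_mk_eq_self_iff M v hv0).2 ⟨l, hv⟩⟩,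
    fun y => Subtype.ext ?_⟩
  obtain ⟨x, hxiso, hxfix⟩ := y
  induction x using Projectivization.ind with
  | h w hw =>
    obtain ⟨n, hn⟩ := (smul_mk_eq_self_iff M w hw).1 hxfix
    obtain ⟨a, ha⟩ := exists_smul_eq_of_sq_eq_zero hsq hne hv0 hv hw hn
    exact (Projectivization.mk_eq_mk_iff' κ w v hw hv0).2 ⟨a, ha⟩

/-- **Two distinct norm-one eigenvalues ⇒ NO fixed isotropic point** (`J = Φ₂`): the eigen-lines of `M` are anisotropic (§1), and a fixed point of
`M` on `ℙ(κ²)` is an eigen-line. [cite: Kottwitz1988, §2] -/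
theorem natCard_isotropic_fixed_eq_zero_of_eigenpair [Finite κ] (M : GL (Fin 2) κ)
    (hM : ((M : Matrix (Fin 2) (Fin 2) κ).map τ)ᵀ * !![(0 : κ), 1; 1, 0] * (M : Matrix (Fin 2) (Fin 2) κ) = !![(0 : κ), 1; 1, 0])
    {v w : Fin 2 → κ} {l m : κ} (hv : (M : Matrix (Fin 2) (Fin 2) κ) *ᵥ v = l • v) (hw : (M : Matrix (Fin 2) (Fin 2) κ) *ᵥ w = m • w)
    (hv0 : v ≠ 0) (hw0 : w ≠ 0) (hlm : l ≠ m) (hl : τ l * l = 1) (hm : τ m * m = 1) :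
    Nat.card {x : Projectivization κ (Fin 2 → κ) // ((τ ∘ x.rep) ᵥ* !![(0 : κ), 1; 1, 0]) ⬝ᵥ x.rep = 0 ∧ M • x = x} = 0 := by
  have hJ : IsUnit (!![(0 : κ), 1; 1, 0]).det := by rw [det_fin_two_of]; simp
  rw [Nat.card_eq_zero]
  left
  refine ⟨fun ⟨x, hxiso, hxfix⟩ => ?_⟩
  induction x using Projectivization.ind with
  | h y hy =>
    obtain ⟨n, hn⟩ := (smul_mk_eq_self_iff M y hy).1 hxfix
    exact dotProduct_self_ne_zero_of_eigenpair_of_mulVec_eq_smul τ hJ hM hv hw hv0 hw0 hlm hl hm hy hn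
      ((vecMul_dotProduct_rep_eq_zero_iff τ _ y hy).1 hxiso)

end ProjectiveLine

/-! ## §3 Reduction of `K = U(σ, Φ₂) ∩ GL₂(𝒪)` modulo `𝓂` -/

section Valued

variable {F : Type*} [Field F] [ValuativeRel F] (σ : F →+* F) (σO : 𝒪[F] →+* 𝒪[F])
  (hσO' : ∀ x : 𝒪[F], ((σO x : 𝒪[F]) : F) = σ x) (τ : 𝓀[F] →+* 𝓀[F])
  (hτ : ∀ x : 𝒪[F], IsLocalRing.residue 𝒪[F] (σO x) = τ (IsLocalRing.residue 𝒪[F] x))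

/-- `Φ₂ = antidiag(1, 1)` is preserved by `Matrix.map` of a ring homomorphism. [cite: Rogawski1990, §12.6 p. 174] -/
theorem map_antidiagTwo {R S : Type*} [Semiring R] [Semiring S] (f : R →+* S) :
    (!![(0 : R), 1; 1, 0] : Matrix (Fin 2) (Fin 2) R).map f = !![(0 : S), 1; 1, 0] := by
  ext i j; fin_cases i <;> fin_cases j <;> simp

/-- The entries of `k ∈ K = U ∩ GL₂(𝒪)` are integral. [cite: IwahoriMatsumoto1965, §2] -/
theorem apply_mem_integer_of_mem_subgroupOf {J : Matrix (Fin 2) (Fin 2) F} (k : ↥((glInt 2 F).subgroupOf (unitaryGroupOfForm σ J)))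
    (i j : Fin 2) : (((k : ↥(unitaryGroupOfForm σ J)) : GL (Fin 2) F) : Matrix (Fin 2) (Fin 2) F) i j ∈ 𝒪[F] :=
  apply_mem_integer_of_mem_glInt k.2 i j

/-- The reduction `k̄` of `k ∈ K` is the residue of the INTEGRAL MODEL `kO` of `k`: `k̄ = kO mod 𝓂` as matrices. [cite: IwahoriMatsumoto1965, §2] -/
theorem coe_glIntReduction_eq_map {J : Matrix (Fin 2) (Fin 2) F} (k : ↥((glInt 2 F).subgroupOf (unitaryGroupOfForm σ J))) :
    ((glIntReduction 2 F ⟨((k : ↥(unitaryGroupOfForm σ J)) : GL (Fin 2) F), k.2⟩ : GL (Fin 2) 𝓀[F]) : Matrix (Fin 2) (Fin 2) 𝓀[F]) =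
      (Matrix.of fun i j => (⟨(((k : ↥(unitaryGroupOfForm σ J)) : GL (Fin 2) F) : Matrix (Fin 2) (Fin 2) F) i j,
        apply_mem_integer_of_mem_subgroupOf σ k i j⟩ : 𝒪[F])).map (IsLocalRing.residue 𝒪[F]) := by
  ext i j
  rw [coe_glIntReduction_apply, map_apply, of_apply]

include hσO' hτ in
/-- **The reduction of `k ∈ U(σ, Φ₂) ∩ GL₂(𝒪)` is `τ`-unitary for `Φ₂` over the residue field**: `ᵗτ(k̄) Φ₂ k̄ = Φ₂` (reduce the integral
identity `ᵗσ(k) Φ₂ k = Φ₂`). [cite: Rogawski1990, §12.6 p. 174] [cite: IwahoriMatsumoto1965, §2] -/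
theorem transpose_map_glIntReduction_mul_antidiagTwo_mul {J : Matrix (Fin 2) (Fin 2) F} (hJ : J = !![0, 1; 1, 0])
    (k : ↥((glInt 2 F).subgroupOf (unitaryGroupOfForm σ J))) :
    (((glIntReduction 2 F ⟨((k : ↥(unitaryGroupOfForm σ J)) : GL (Fin 2) F), k.2⟩ : GL (Fin 2) 𝓀[F]) : Matrix (Fin 2) (Fin 2) 𝓀[F]).map τ)ᵀ *
        !![(0 : 𝓀[F]), 1; 1, 0] * ((glIntReduction 2 F ⟨((k : ↥(unitaryGroupOfForm σ J)) : GL (Fin 2) F), k.2⟩ : GL (Fin 2) 𝓀[F]) :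
          Matrix (Fin 2) (Fin 2) 𝓀[F]) = !![(0 : 𝓀[F]), 1; 1, 0] := by
  subst hJ
  set kO : Matrix (Fin 2) (Fin 2) 𝒪[F] := Matrix.of fun i j => (⟨(((k : ↥(unitaryGroupOfForm σ !![(0 : F), 1; 1, 0])) : GL (Fin 2) F) :
    Matrix (Fin 2) (Fin 2) F) i j, apply_mem_integer_of_mem_subgroupOf σ k i j⟩ : 𝒪[F]) with hkO
  have hkOF : kO.map (𝒪[F]).subtype = (((k : ↥(unitaryGroupOfForm σ !![(0 : F), 1; 1, 0])) : GL (Fin 2) F) : Matrix (Fin 2) (Fin 2) F) := by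
    ext i j; rfl
  -- the integral identity `ᵗσO(kO) Φ₂ kO = Φ₂` (its image in `F` is the unitarity of `k`)
  have hint : (kO.map σO)ᵀ * !![(0 : 𝒪[F]), 1; 1, 0] * kO = !![(0 : 𝒪[F]), 1; 1, 0] := by
    have hU := (mem_unitaryGroupOfForm_iff.1 (k : ↥(unitaryGroupOfForm σ !![(0 : F), 1; 1, 0])).2)
    apply Matrix.map_injective (f := ((𝒪[F]).subtype : 𝒪[F] → F)) Subtype.val_injective
    dsimp only
    have hσc : ((𝒪[F]).subtype : 𝒪[F] → F) ∘ σO = σ ∘ ((𝒪[F]).subtype : 𝒪[F] → F) := by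
      funext x; exact hσO' x
    rw [Matrix.map_mul, Matrix.map_mul, transpose_map, map_map, hσc, ← map_map, hkOF, map_antidiagTwo]
    exact hU
  -- reduce modulo `𝓂`
  have hred := congrArg (fun M : Matrix (Fin 2) (Fin 2) 𝒪[F] => M.map (IsLocalRing.residue 𝒪[F])) hint
  simp only [Matrix.map_mul, map_antidiagTwo] at hred
  have hτc : (IsLocalRing.residue 𝒪[F] : 𝒪[F] → 𝓀[F]) ∘ σO = τ ∘ (IsLocalRing.residue 𝒪[F] : 𝒪[F] → 𝓀[F]) := by
    funext x; exact hτ x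
  rw [transpose_map, map_map, hτc, ← map_map] at hred
  rw [coe_glIntReduction_eq_map]
  exact hred

/-- `M (1, 0)ᵀ = (M₀₀, M₁₀)ᵀ` (the first column). [cite: HornJohnson2013, §0.2] -/
theorem mulVec_vecTwo_one_zero {R : Type*} [CommSemiring R] (M : Matrix (Fin 2) (Fin 2) R) : M *ᵥ ![1, 0] = ![M 0 0, M 1 0] := by
  funext i; fin_cases i <;> simp [mulVec, dotProduct, Fin.sum_univ_two]

/-- **The Iwahori subgroup is the stabiliser of `⟨ē₀⟩`**: for `k ∈ K`, `k ∈ I` iff `k̄` fixes the point `⟨(1, 0)⟩` of `ℙ(𝓀²)` (`I` = lower-left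
entry in `𝓂` = `k̄₁₀ = 0`). [cite: IwahoriMatsumoto1965, §2 Prop. 2.4] [cite: Serre1980Trees, Ch. II §1.1] -/
theorem mem_iwahori_subgroupOf_iff_smul_eq {J : Matrix (Fin 2) (Fin 2) F} (k : ↥((glInt 2 F).subgroupOf (unitaryGroupOfForm σ J)))
    (h10 : (![1, 0] : Fin 2 → 𝓀[F]) ≠ 0) :
    k ∈ ((iwahoriGL 2 F).subgroupOf (unitaryGroupOfForm σ J)).subgroupOf ((glInt 2 F).subgroupOf (unitaryGroupOfForm σ J)) ↔
      (glIntReduction 2 F ⟨((k : ↥(unitaryGroupOfForm σ J)) : GL (Fin 2) F), k.2⟩ : GL (Fin 2) 𝓀[F]) • Projectivization.mk 𝓀[F] ![1, 0] h10 =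
        Projectivization.mk 𝓀[F] ![1, 0] h10 := by
  rw [Subgroup.mem_subgroupOf, Subgroup.mem_subgroupOf, mem_iwahoriGL_iff, smul_mk_eq_self_iff, mulVec_vecTwo_one_zero]
  constructor
  · rintro ⟨-, h⟩
    refine ⟨((glIntReduction 2 F ⟨((k : ↥(unitaryGroupOfForm σ J)) : GL (Fin 2) F), k.2⟩ : GL (Fin 2) 𝓀[F]) : Matrix (Fin 2) (Fin 2) 𝓀[F]) 0 0, ?_⟩
    have h10' := (glIntReduction_apply_eq_zero_iff ⟨((k : ↥(unitaryGroupOfForm σ J)) : GL (Fin 2) F), k.2⟩ 1 0).2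
      (h 1 0 (by decide))
    funext i; fin_cases i
    · simp
    · simp [h10']
  · rintro ⟨a, ha⟩
    refine ⟨k.2, fun i j hji => ?_⟩
    have hij : i = 1 ∧ j = 0 := by
      fin_cases i <;> fin_cases j <;> simp_all
    obtain ⟨rfl, rfl⟩ := hij
    rw [← glIntReduction_apply_eq_zero_iff ⟨((k : ↥(unitaryGroupOfForm σ J)) : GL (Fin 2) F), k.2⟩ 1 0]
    have := congrFun ha 1
    simpa using this

include hσO' hτ in
/-- **The orbit of `⟨ē₀⟩` consists of isotropic points**: for `k ∈ K`, `k̄ ⟨ē₀⟩ = ⟨first column of k̄⟩` is `Φ₂`-isotropic (the `(0,0)` entry of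
`ᵗτ(k̄) Φ₂ k̄ = Φ₂`). [cite: Kottwitz1988, §2] [cite: Serre1980Trees, Ch. II §1.1] -/
theorem isotropic_glIntReduction_smul {J : Matrix (Fin 2) (Fin 2) F} (hJ : J = !![0, 1; 1, 0])
    (k : ↥((glInt 2 F).subgroupOf (unitaryGroupOfForm σ J))) (h10 : (![1, 0] : Fin 2 → 𝓀[F]) ≠ 0) :
    ((τ ∘ ((glIntReduction 2 F ⟨((k : ↥(unitaryGroupOfForm σ J)) : GL (Fin 2) F), k.2⟩ : GL (Fin 2) 𝓀[F]) •
        Projectivization.mk 𝓀[F] ![1, 0] h10).rep) ᵥ* !![(0 : 𝓀[F]), 1; 1, 0]) ⬝ᵥ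
      ((glIntReduction 2 F ⟨((k : ↥(unitaryGroupOfForm σ J)) : GL (Fin 2) F), k.2⟩ : GL (Fin 2) 𝓀[F]) •
        Projectivization.mk 𝓀[F] ![1, 0] h10).rep = 0 := by
  have hM := transpose_map_glIntReduction_mul_antidiagTwo_mul σ σO hσO' τ hτ hJ k
  set M : Matrix (Fin 2) (Fin 2) 𝓀[F] := ((glIntReduction 2 F ⟨((k : ↥(unitaryGroupOfForm σ J)) : GL (Fin 2) F), k.2⟩ :
    GL (Fin 2) 𝓀[F]) : Matrix (Fin 2) (Fin 2) 𝓀[F]) with hMdef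
  rw [Projectivization.smul_mk, vecMul_dotProduct_rep_eq_zero_iff]
  change ((τ ∘ (M *ᵥ ![1, 0])) ᵥ* !![(0 : 𝓀[F]), 1; 1, 0]) ⬝ᵥ (M *ᵥ ![1, 0]) = 0
  have h00 := congrFun (congrFun hM 0) 0
  rw [mulVec_vecTwo_one_zero, vecMul_antidiag_dotProduct]
  simp only [cons_val_zero, cons_val_one]
  simp [Matrix.mul_apply, Fin.sum_univ_two] at h00
  linear_combination h00

/-- **Trace and determinant of the reduction of an integral `P diag(u) P⁻¹`**: if `k P = P diag(u)` with `k ∈ K` and `u₀, u₁ ∈ 𝒪` then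
`k̄₀₀ + k̄₁₁ = ū₀ + ū₁` and `k̄₀₀ k̄₁₁ − k̄₀₁ k̄₁₀ = ū₀ ū₁` (trace and determinant are similarity invariants). [cite: HornJohnson2013, §1.3] -/
theorem trace_det_glIntReduction_of_eigenframe {J : Matrix (Fin 2) (Fin 2) F} (k : ↥((glInt 2 F).subgroupOf (unitaryGroupOfForm σ J)))
    {P : GL (Fin 2) F} {u : Fin 2 → F} (hP : (((k : ↥(unitaryGroupOfForm σ J)) : GL (Fin 2) F) : Matrix (Fin 2) (Fin 2) F) * P = P * diagonal u)
    (hu : ∀ i, u i ∈ 𝒪[F]) :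
    ((glIntReduction 2 F ⟨((k : ↥(unitaryGroupOfForm σ J)) : GL (Fin 2) F), k.2⟩ : GL (Fin 2) 𝓀[F]) : Matrix (Fin 2) (Fin 2) 𝓀[F]) 0 0 +
        ((glIntReduction 2 F ⟨((k : ↥(unitaryGroupOfForm σ J)) : GL (Fin 2) F), k.2⟩ : GL (Fin 2) 𝓀[F]) : Matrix (Fin 2) (Fin 2) 𝓀[F]) 1 1 =
        IsLocalRing.residue 𝒪[F] ⟨u 0, hu 0⟩ + IsLocalRing.residue 𝒪[F] ⟨u 1, hu 1⟩ ∧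
      ((glIntReduction 2 F ⟨((k : ↥(unitaryGroupOfForm σ J)) : GL (Fin 2) F), k.2⟩ : GL (Fin 2) 𝓀[F]) : Matrix (Fin 2) (Fin 2) 𝓀[F]) 0 0 *
          ((glIntReduction 2 F ⟨((k : ↥(unitaryGroupOfForm σ J)) : GL (Fin 2) F), k.2⟩ : GL (Fin 2) 𝓀[F]) : Matrix (Fin 2) (Fin 2) 𝓀[F]) 1 1 -
        ((glIntReduction 2 F ⟨((k : ↥(unitaryGroupOfForm σ J)) : GL (Fin 2) F), k.2⟩ : GL (Fin 2) 𝓀[F]) : Matrix (Fin 2) (Fin 2) 𝓀[F]) 0 1 *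
          ((glIntReduction 2 F ⟨((k : ↥(unitaryGroupOfForm σ J)) : GL (Fin 2) F), k.2⟩ : GL (Fin 2) 𝓀[F]) : Matrix (Fin 2) (Fin 2) 𝓀[F]) 1 0 =
        IsLocalRing.residue 𝒪[F] ⟨u 0, hu 0⟩ * IsLocalRing.residue 𝒪[F] ⟨u 1, hu 1⟩ := by
  set g : GL (Fin 2) F := ((k : ↥(unitaryGroupOfForm σ J)) : GL (Fin 2) F) with hg
  -- `g = P diag(u) P⁻¹`
  have hconj : (g : Matrix (Fin 2) (Fin 2) F) = (P : Matrix (Fin 2) (Fin 2) F) * diagonal u * ((P⁻¹ : GL (Fin 2) F) : Matrix (Fin 2) (Fin 2) F) := by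
    rw [← hP, Matrix.mul_assoc, ← Units.val_mul, mul_inv_cancel, Units.val_one, Matrix.mul_one]
  have htr : (g : Matrix (Fin 2) (Fin 2) F) 0 0 + (g : Matrix (Fin 2) (Fin 2) F) 1 1 = u 0 + u 1 := by
    have h := trace_units_conj P (diagonal u)
    rw [← hconj, trace_fin_two, trace_fin_two] at h
    simpa [diagonal_apply_eq, diagonal_apply_ne] using h
  have hdet : (g : Matrix (Fin 2) (Fin 2) F) 0 0 * (g : Matrix (Fin 2) (Fin 2) F) 1 1 - (g : Matrix (Fin 2) (Fin 2) F) 0 1 * (g : Matrix (Fin 2) (Fin 2) F) 1 0 =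
      u 0 * u 1 := by
    have h := det_units_conj P (diagonal u)
    rw [← hconj, det_fin_two, det_diagonal, Fin.prod_univ_two] at h
    exact h
  simp only [coe_glIntReduction_apply, ← map_add, ← map_mul, ← map_sub]
  constructor
  · congr 1; exact Subtype.ext htr
  · congr 1; exact Subtype.ext hdet

end Valued

end Literature.NumberTheory.Automorphic
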